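import Literature.Geometry.Kaehler.CousinChartConvex
import Literature.Analysis.Complex.SmoothHypersurfaceDivision
import HarnessLib

/-!
# Holomorphic extension from a smooth hypersurface of a convex domain

H. Cartan's Théorème B in its most classical use (H. Cartan, Séminaire 1951–52; K. Fritzsche,
H. Grauert, *From Holomorphic Functions to Complex Manifolds* (2002), Ch. V §3, "extension of
holomorphic functions from analytic subsets of Stein manifolds"), in the degree-one, smooth
hypersurface, convex-domain case that the tree can now prove from its own Cousin I
(`exists_holomorphic_cochain_of_cocycle_of_convex`, file `CousinChartConvex`) and division
(`SCV.exists_eq_smul_of_eqOn_zero`, file `SmoothHypersurfaceDivision`) theorems: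

* `exists_differentiableOn_forall_eq_of_local` — let `Ω` be a convex open subset of a
  finite-dimensional complex normed space, `t` holomorphic on `Ω` with `dt ≠ 0` along
  `Y = {t = 0} ∩ Ω`, and `f` a function which near every point of `Y` agrees ON `Y` with some
  holomorphic function (i.e. `f|_Y` is holomorphic on the submanifold `Y`). Then there is ONE
  holomorphic `F` on `Ω` with `F = f` on `Y`.

Proof: the local extensions `F_N` and `0` on `Ω ∖ Y` form a `0`-cochain whose differences vanish
on `Y`, hence are `t · g_{NN'}` (division); by uniqueness of the quotient the `g` form a
`1`-cocycle, which Cousin I writes as `r_N - r_{N'}`; then the `F_N - t r_N` glue. This is the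
surjectivity of `𝒪(Ω) → 𝒪_Y(Y ∩ Ω)` in the exact sequence `0 → 𝒪 →ᵗ 𝒪 → 𝒪_Y → 0` over a convex
(chart-convex) open set, the input identifying the cokernel of `t` on Čech cochains with the Čech
cochains of the hyperplane section.

Everything is proved; theorems only.

## References

* K. Fritzsche, H. Grauert, *From Holomorphic Functions to Complex Manifolds*, GTM 213 (2002),
  Ch. V §1 Prop. 1.6, §3. [FritzscheGrauert2002]
* E. M. Chirka, *Complex Analytic Sets* (1989), §2.8. [Chirka1989]
-/

noncomputable section

open scoped Topology
open Set Filter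

namespace Literature.Geometry.Kaehler

variable {E : Type*} [NormedAddCommGroup E] [NormedSpace ℂ E] [FiniteDimensional ℂ E]

/-- **Holomorphic extension from a smooth hypersurface of a convex domain** (Cartan's Theorem B,
degree one, for `0 → 𝒪 →ᵗ 𝒪 → 𝒪_Y → 0` on a convex open set). Let `Ω` be convex open in a
finite-dimensional complex normed space, `t` holomorphic on `Ω` with `dt(x) ≠ 0` at every zero
`x ∈ Ω`, and let `f : E → ℂ` be LOCALLY ON `Y = {t = 0} ∩ Ω` the restriction of holomorphic
functions: every `y ∈ Y` has an open `N ∋ y`, `N ⊆ Ω`, and `F_N` holomorphic on `N` with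
`F_N = f` on `Y ∩ N`. Then some `F` holomorphic on all of `Ω` satisfies `F = f` on `Y`.
[cite: FritzscheGrauert2002, Ch. V §1 Prop. 1.6 and §3] -/
theorem exists_differentiableOn_forall_eq_of_local {Ω : Set E} (hΩo : IsOpen Ω) (hΩc : Convex ℝ Ω)
    {t : E → ℂ} (ht : DifferentiableOn ℂ t Ω) (hdt : ∀ x ∈ Ω, t x = 0 → fderiv ℂ t x ≠ 0)
    {f : E → ℂ}
    (hf : ∀ y ∈ Ω, t y = 0 → ∃ N : Set E, IsOpen N ∧ y ∈ N ∧ N ⊆ Ω ∧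
      ∃ F : E → ℂ, DifferentiableOn ℂ F N ∧ ∀ z ∈ N, t z = 0 → F z = f z) :
    ∃ F : E → ℂ, DifferentiableOn ℂ F Ω ∧ ∀ z ∈ Ω, t z = 0 → F z = f z := by
  classical
  -- the index type: points of `Y`, plus one index for `Ω ∖ Y`
  set Ypt := {y : E // y ∈ Ω ∧ t y = 0} with hYpt
  choose N hNo hyN hNΩ FN hFN hFNf using fun y : Ypt ↦ hf y.1 y.2.1 y.2.2
  set Ω₀ : Set E := Ω ∩ t ⁻¹' {0}ᶜ with hΩ₀
  have hΩ₀o : IsOpen Ω₀ := ht.continuousOn.isOpen_inter_preimage hΩo isOpen_compl_singleton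
  set U : Ypt ⊕ Unit → Set E := fun k ↦ Sum.elim N (fun _ ↦ Ω₀) k with hU
  set Floc : Ypt ⊕ Unit → E → ℂ := fun k ↦ Sum.elim FN (fun _ _ ↦ (0 : ℂ)) k with hFloc
  have hUo : ∀ k, IsOpen (U k) := by
    rintro (y | u)
    · exact hNo y
    · exact hΩ₀o
  have hUΩ : ∀ k, U k ⊆ Ω := by
    rintro (y | u)
    · exact hNΩ y
    · exact inter_subset_left
  have hFd : ∀ k, DifferentiableOn ℂ (Floc k) (U k) := by
    rintro (y | u)
    · exact hFN y
    · exact differentiableOn_const 0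
  have hFf : ∀ k, ∀ z ∈ U k, t z = 0 → Floc k z = f z := by
    rintro (y | u) z hz htz
    · exact hFNf y z hz htz
    · exact (hz.2 htz).elim
  have hcov : ∀ x ∈ Ω, ∃ k, x ∈ U k := fun x hx ↦ by
    by_cases htx : t x = 0
    · exact ⟨Sum.inl ⟨x, hx, htx⟩, hyN ⟨x, hx, htx⟩⟩
    · exact ⟨Sum.inr (), hx, htx⟩
  -- differences of local extensions are divisible by `t` on the overlaps
  have hdiv : ∀ k l, ∃ g : E → ℂ, DifferentiableOn ℂ g (U k ∩ U l) ∧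
      ∀ z ∈ U k ∩ U l, Floc k z - Floc l z = t z * g z := fun k l ↦ by
    have hO : IsOpen (U k ∩ U l) := (hUo k).inter (hUo l)
    have hsub : U k ∩ U l ⊆ Ω := inter_subset_left.trans (hUΩ k)
    obtain ⟨g, hg, hfg⟩ := Literature.Analysis.Complex.SCV.exists_eq_smul_of_eqOn_zero hO
      (ht.mono hsub) (((hFd k).mono inter_subset_left).sub ((hFd l).mono inter_subset_right))
      (fun x hx ↦ hdt x (hsub hx)) fun x hx htx ↦ by
        change Floc k x - Floc l x = 0
        rw [hFf k x hx.1 htx, hFf l x hx.2 htx, sub_self]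
    exact ⟨g, hg, fun z hz ↦ by have := hfg z hz; rwa [Pi.sub_apply, smul_eq_mul] at this⟩
  choose g hgd hgf using hdiv
  -- the quotients form a cocycle (uniqueness of the quotient)
  have hcyc : ∀ k l m, ∀ x ∈ U k ∩ U l ∩ U m, g k l x + g l m x = g k m x := by
    intro k l m
    have hO : IsOpen (U k ∩ U l ∩ U m) := ((hUo k).inter (hUo l)).inter (hUo m)
    have hsub : U k ∩ U l ∩ U m ⊆ Ω := (inter_subset_left.trans inter_subset_left).trans (hUΩ k)
    refine Literature.Analysis.Complex.SCV.eqOn_of_smul_eq_smul (g₁ := fun x ↦ g k l x + g l m x)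
      (g₂ := g k m) hO (ht.mono hsub) (fun x hx ↦ hdt x (hsub hx)) ?_ ?_ fun x hx ↦ ?_
    · exact (((hgd k l).mono fun x hx ↦ ⟨hx.1.1, hx.1.2⟩).add
        ((hgd l m).mono fun x hx ↦ ⟨hx.1.2, hx.2⟩)).continuousOn
    · exact ((hgd k m).mono fun x hx ↦ ⟨hx.1.1, hx.2⟩).continuousOn
    · change t x • (g k l x + g l m x) = t x • g k m x
      simp only [smul_eq_mul]
      have h1 := hgf k l x ⟨hx.1.1, hx.1.2⟩
      have h2 := hgf l m x ⟨hx.1.2, hx.2⟩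
      have h3 := hgf k m x ⟨hx.1.1, hx.2⟩
      linear_combination -h1 - h2 + h3
  -- Cousin I on the convex `Ω`
  obtain ⟨r, hr, hgr⟩ := exists_holomorphic_cochain_of_cocycle_of_convex hΩo hΩc U hUo hUΩ hcov g
    hgd hcyc
  -- the corrected local extensions glue
  have hglue : ∀ k l, ∀ z ∈ U k ∩ U l,
      Floc k z - t z * r k z = Floc l z - t z * r l z := fun k l z hz ↦ by
    have h1 := hgf k l z hz
    have h2 := hgr k l z hz
    rw [h2] at h1
    linear_combination h1
  set kx : E → Ypt ⊕ Unit := fun x ↦ if hx : x ∈ Ω then Classical.choose (hcov x hx) else Sum.inr ()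
    with hkx
  have hkx_mem : ∀ x ∈ Ω, x ∈ U (kx x) := fun x hx ↦ by
    simp only [hkx, dif_pos hx]
    exact Classical.choose_spec (hcov x hx)
  refine ⟨fun x ↦ Floc (kx x) x - t x * r (kx x) x, fun x hx ↦ ?_, fun z hz htz ↦ ?_⟩
  · -- holomorphic: near `x`, agrees with `Floc k - t r_k` for the fixed index `k = kx x`
    set k := kx x with hk
    have hxk : x ∈ U k := hkx_mem x hx
    have hev : (fun y ↦ Floc (kx y) y - t y * r (kx y) y) =ᶠ[𝓝 x] fun y ↦ Floc k y - t y * r k y := by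
      filter_upwards [(hUo k).mem_nhds hxk] with y hy
      exact hglue (kx y) k y ⟨hkx_mem y (hUΩ k hy), hy⟩
    have hd : DifferentiableAt ℂ (fun y ↦ Floc k y - t y * r k y) x :=
      (((hFd k).sub ((ht.mono (hUΩ k)).mul (hr k))).differentiableAt ((hUo k).mem_nhds hxk))
    exact (hd.congr_of_eventuallyEq hev).differentiableWithinAt
  · change Floc (kx z) z - t z * r (kx z) z = f z
    rw [htz, zero_mul, sub_zero, hFf (kx z) z (hkx_mem z hz) htz]

end Literature.Geometry.Kaehler
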